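import Literature.AlgebraicGeometry.ModuliOfAbelianVarieties.SiegelAdelicMarkingCoverPairingReading
import Literature.NumberTheory.Adeles.FiniteAdeleLatticeOfGLLevel
import Literature.NumberTheory.Adeles.RatFiniteIdeleCongruenceClasses
import HarnessLib

/-!
# The TORSION TRANSPORTER of a homomorphism reading a rational matrix between two adelically-read torsion towers

Topic `AlgebraicGeometry/ModuliOfAbelianVarieties`; namespace `Literature.AlgebraicGeometry.ModuliOfAbelianVarieties`.  THEOREMS ONLY (no definition,
no named fact, no instance, no notation, no `sorry`).  Cell `hodgecm-mathlib` (D-0151), FLOOR 0, P6 «MOD programme» (crux hLiu418 = stmt-HodgeConjecture-24832,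
`--supports`, count-neutral), EHECKE closer organs (O-R1)∕(O-R2), shared assembler kit (ρ-SIM) §6.  HC_CM is proved only modulo the printed citations until
rung 0 closes.

SETTING ([Milne2005ShimuraVarieties] Thm. 6.11 p. 74 and p. 75 «`V/Λ ≅ V(𝔸_f)/Λ̂`»).  Two complex abelian varieties `A₁`, `A₂` marked by `[J₁, r₁]`, `[J₂, r₂]`
(★ `SiegelAdelicMarking`, torsion parametrisations `uᵢ = mᵢ.r : V = ℚ^{2g} → Aᵢ(ℂ)`), a homomorphism `h : A₁ ⟶ A₂` READING a rational matrix `Q`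
(`h (u₁ v) = u₂ (Q v)`), and two TORSION TOWERS `Lᵢ M : (ℤ∕M)^{2g} → Aᵢ(ℂ)` READ ADELICALLY through `rᵢ`:
`rᵢ⁻¹ ŵ ≡ x̃∕M (mod ẑ^{2g}) ⟹ Lᵢ M x = uᵢ(w)` (the shape ★ `SymplecticLift` readings take in the cell, levels `N ∣ M`).  Put
`G := r₂⁻¹ · Q̂ · r₁ ∈ M_{2g}(𝔸_{ℚ,f})`.

* §1 `exists_nat_mul_entries_mem_integralAdeles` (denominators of an adelic matrix) and **`entries_mem_integralAdeles_of_forall_mulVec_mem_latticeOfGL`**: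
  the lattice inclusion `Q Λ_{r₁} ⊆ Λ_{r₂}` forces `G ∈ M_{2g}(ẑ)` (density of `Λ_{r₁}` in `r₁ẑ^{2g}`, ★ `exists_mem_latticeOfGL_mulVec_sub_mem_levelIdeal`).
* §2 **`SiegelAdelicMarking.exists_torsionTransporter`**: if `G` is integral and `ᵗG ψ_δ G = (ν·ε)·ψ_δ` with `ν ∈ ℕ`, `ε ∈ ẑ^×`, there is a family
  `T̄_M : (ℤ∕M)^{2g} → (ℤ∕M)^{2g}` (namely `x ↦ G·x̃ mod M`) with (i) `h (L₁ M x) = L₂ M (T̄_M x)` and (ii) `E_δ(T̄_M x, T̄_M y) = (u_M·ν)·E_δ(x, y)` in `ℤ∕M`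
  for a unit `u_M = ε mod M` — EXACTLY the binders `hT`, `hνT` of ★ `AbelianSchemeOver.comp_lam_comp_dualIsogenyOver_eq_mulN_of_towerReadings_unit`
  (there after transport to the identity fibre, ★ `IdentityFibreTowerTransport`).  Proof = the road of ★ `SiegelAdelicMarking.pairingReading_comp_of_similitude`:
  reduction homomorphisms `ρ_M : ẑ → ℤ∕M` (★ `exists_ringHom_integralAdeles_zmod`), ★ `adelicCongr_one_intDiv_iff`, ★ `ringHom_sum_sum_mul_typeForm_mul`,
  ★ `dotProduct_mulVec_typeFormOver_mulVec_of_transpose_mul_mul`.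

References: [Milne2005ShimuraVarieties] J. S. Milne, *Introduction to Shimura varieties* (2005), §4 pp. 48–49, §6 Thm. 6.11 p. 74 and p. 75;
[Deligne1971TravauxShimura] P. Deligne, *Travaux de Shimura* (1971), 4.12 (b) p. 149, 4.16 p. 150; [MumfordAV1970] D. Mumford, *Abelian Varieties* (1970), §20, §23;
[CasselsFrohlichANT1967] Cassels–Fröhlich, *Algebraic Number Theory* (1967), Ch. II §15.
-/

set_option autoImplicit false

noncomputable section

open Matrix CategoryTheory AlgebraicGeometry NumberField IsDedekindDomain
open Literature.AlgebraicGeometry.Motives (AbelianVariety AlgPoints)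
open Literature.AlgebraicGeometry.AbelianSchemes (AbelianSchemeOver)
open Literature.NumberTheory.Adeles (latticeOfGL exists_ringHom_integralAdeles_zmod ringHom_integralAdeles_zmod_apply_eq_intCast_iff
  exists_mem_latticeOfGL_mulVec_sub_mem_levelIdeal mem_integralAdeles_iff_mem_integralFiniteAdeles mem_latticeOfGL_iff)

namespace Literature.AlgebraicGeometry.ModuliOfAbelianVarieties

variable {g : ℕ} {δ : Fin g → ℕ}

/-! ## §1 Denominators; integrality of `r₂⁻¹ Q̂ r₁` from the lattice inclusion `Q Λ_{r₁} ⊆ Λ_{r₂}` -/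

/-- Every finite adèle of `ℚ` has a denominator in `ℕ` (via the unipotent matrix `(1 x; 0 1)` and ★ `exists_nat_mul_entries_mem`). [cite: CasselsFrohlichANT1967, Ch. II §14] -/
theorem exists_nat_mul_mem_integralAdeles (x : finAdeleQ) :
    ∃ N : ℕ, N ≠ 0 ∧ (N : finAdeleQ) * x ∈ FiniteAdeleRing.integralAdeles (𝓞 ℚ) ℚ := by
  obtain ⟨N, hN, h, -⟩ := Literature.NumberTheory.Adeles.exists_nat_mul_entries_mem
    (⟨!![1, x; 0, 1], !![1, -x; 0, 1], by simp [Matrix.one_fin_two], by simp [Matrix.one_fin_two]⟩ : GL (Fin 2) finAdeleQ)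
  exact ⟨N, hN, (mem_integralAdeles_iff_mem_integralFiniteAdeles _).2 (by simpa using h 0 1)⟩

/-- A matrix over `𝔸_{ℚ,f}` has a common denominator in `ℕ`. [cite: CasselsFrohlichANT1967, Ch. II §14] -/
theorem exists_nat_mul_entries_mem_integralAdeles {m n : Type*} [Fintype m] [Fintype n] (G : Matrix m n finAdeleQ) :
    ∃ N : ℕ, N ≠ 0 ∧ ∀ i j, (N : finAdeleQ) * G i j ∈ FiniteAdeleRing.integralAdeles (𝓞 ℚ) ℚ := by
  classical
  choose N hN hNx using fun p : m × n => exists_nat_mul_mem_integralAdeles (G p.1 p.2)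
  refine ⟨∏ p, N p, Finset.prod_ne_zero_iff.2 fun p _ => hN p, fun i j => ?_⟩
  rw [← Finset.mul_prod_erase Finset.univ N (Finset.mem_univ (i, j)), Nat.cast_mul, mul_comm ((N (i, j) : ℕ) : finAdeleQ), mul_assoc]
  exact mul_mem (natCast_mem _ _) (hNx (i, j))

/-- `(G e_j)_i = G_{ij}`. [folklore] -/
private theorem mulVec_single_one_apply {n : Type*} [Fintype n] [DecidableEq n] {R : Type*} [Semiring R] (G : Matrix n n R) (i j : n) :
    (G *ᵥ Pi.single j 1) i = G i j := by
  rw [Matrix.mulVec, dotProduct, Finset.sum_eq_single j (fun l _ hl => by rw [Pi.single_eq_of_ne hl, mul_zero])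
    (fun h => absurd (Finset.mem_univ j) h), Pi.single_eq_same, mul_one]

/-- **`Q Λ_{r₁} ⊆ Λ_{r₂}` ⟹ `r₂⁻¹ Q̂ r₁ ∈ M_{2g}(ẑ)`**: the `j`-th column of `G = r₂⁻¹ Q̂ r₁` is `G e_j = r₂⁻¹ (Q q)^ − G (r₁⁻¹ q̂ − e_j)` for a lattice vector
`q ∈ Λ_{r₁}` with `r₁⁻¹ q̂ ≡ e_j (mod N ẑ^{2g})`, `N` a denominator of `G` (★ `exists_mem_latticeOfGL_mulVec_sub_mem_levelIdeal`); both terms are integral.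
[cite: Milne2005ShimuraVarieties, §6 Thm. 6.11 p. 74 and p. 75] [cite: Deligne1971TravauxShimura, 4.16 p. 150] -/
theorem entries_mem_integralAdeles_of_forall_mulVec_mem_latticeOfGL (r₁ r₂ : GL (Fin g ⊕ Fin g) finAdeleQ)
    (Q : Matrix (Fin g ⊕ Fin g) (Fin g ⊕ Fin g) ℚ) (hQ : ∀ v ∈ latticeOfGL r₁, Q *ᵥ v ∈ latticeOfGL r₂) (i j : Fin g ⊕ Fin g) :
    (((r₂⁻¹ : GL (Fin g ⊕ Fin g) finAdeleQ) : Matrix (Fin g ⊕ Fin g) (Fin g ⊕ Fin g) finAdeleQ) * adelicMatrix Q *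
        (r₁ : Matrix (Fin g ⊕ Fin g) (Fin g ⊕ Fin g) finAdeleQ)) i j ∈ FiniteAdeleRing.integralAdeles (𝓞 ℚ) ℚ := by
  classical
  set G := ((r₂⁻¹ : GL (Fin g ⊕ Fin g) finAdeleQ) : Matrix (Fin g ⊕ Fin g) (Fin g ⊕ Fin g) finAdeleQ) * adelicMatrix Q *
    (r₁ : Matrix (Fin g ⊕ Fin g) (Fin g ⊕ Fin g) finAdeleQ) with hGdef
  obtain ⟨N, hN, hNG⟩ := exists_nat_mul_entries_mem_integralAdeles G
  -- a lattice vector `q ∈ Λ_{r₁}` with `r₁⁻¹ q̂ ≡ e_j (mod N)`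
  have hy : ∀ l, (Pi.single j 1 : Fin g ⊕ Fin g → finAdeleQ) l ∈ Literature.NumberTheory.Automorphic.integralFiniteAdeles ℚ := fun l => by
    by_cases hl : l = j
    · subst hl; rw [Pi.single_eq_same]; exact one_mem _
    · rw [Pi.single_eq_of_ne hl]; exact zero_mem _
  obtain ⟨q, hq, hqN⟩ := exists_mem_latticeOfGL_mulVec_sub_mem_levelIdeal hN r₁ hy
  -- `G e_j = G (r₁⁻¹ q̂) - G (r₁⁻¹ q̂ - e_j)`
  set z : Fin g ⊕ Fin g → finAdeleQ :=
    ((r₁⁻¹ : GL (Fin g ⊕ Fin g) finAdeleQ) : Matrix (Fin g ⊕ Fin g) (Fin g ⊕ Fin g) finAdeleQ) *ᵥ (⇑(algebraMap ℚ finAdeleQ) ∘ q) with hz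
  have hsplit : G i j = (G *ᵥ z) i - (G *ᵥ (z - Pi.single j 1)) i := by
    rw [Matrix.mulVec_sub, Pi.sub_apply, sub_sub_cancel, mulVec_single_one_apply]
  rw [hsplit]
  refine sub_mem ?_ ?_
  · -- `G (r₁⁻¹ q̂) = r₂⁻¹ (Q q)^`, integral since `Q q ∈ Λ_{r₂}`
    have e : G *ᵥ z = ((r₂⁻¹ : GL (Fin g ⊕ Fin g) finAdeleQ) : Matrix (Fin g ⊕ Fin g) (Fin g ⊕ Fin g) finAdeleQ) *ᵥ
        (⇑(algebraMap ℚ finAdeleQ) ∘ (Q *ᵥ q)) := by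
      rw [hz, hGdef, Matrix.mulVec_mulVec, Matrix.mul_assoc, ← Units.val_mul, mul_inv_cancel, Units.val_one, Matrix.mul_one,
        ← Matrix.mulVec_mulVec]
      congr 1
      exact adelicMatrix_mulVec_adelicVec Q q
    rw [e]
    exact (mem_integralAdeles_iff_mem_integralFiniteAdeles _).2 (mem_latticeOfGL_iff.1 (hQ q hq) i)
  · -- `G (r₁⁻¹ q̂ - e_j)`: coordinates in `N ẑ`, and `N G` is integral
    rw [Matrix.mulVec, dotProduct]
    refine sum_mem fun l _ => ?_
    obtain ⟨y, hy', hyl⟩ := mem_levelIdeal_iff.1 (hqN l)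
    rw [Pi.sub_apply, ← hyl, ← mul_assoc, mul_comm (G i l)]
    exact mul_mem (hNG i l) hy'

/-! ## §2 The torsion transporter -/

/-- **THE TORSION TRANSPORTER OF `h` BETWEEN TWO ADELICALLY-READ TOWERS.**  Markings `m₁`, `m₂` of `A₁`, `A₂` by `[J₁, r₁]`, `[J₂, r₂]`; a homomorphism `h : A₁ ⟶ A₂`
reading the rational matrix `Q` (`hh`); torsion towers `L₁`, `L₂` read adelically through `r₁`, `r₂` at the levels `N ∣ M` (`hL₁`, `hL₂`); `G := r₂⁻¹ Q̂ r₁` integral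
(`hG`, e.g. ★ `entries_mem_integralAdeles_of_forall_mulVec_mem_latticeOfGL`) with `ᵗG ψ_δ G = (ν·ε) ψ_δ`, `ν ∈ ℕ`, `ε ∈ ẑ^×` (`hGE`).  THEN there is a family
`T̄_M : (ℤ∕M)^{2g} → (ℤ∕M)^{2g}` with **(i) `h (L₁ M x) = L₂ M (T̄_M x)`** and **(ii) `E_δ(T̄_M x, T̄_M y) = (u_M·ν)·E_δ(x, y)` in `ℤ∕M` for some `u_M` coprime to
`M`** (`N ∣ M`, `M ≠ 0`).  Construction: `T̄_M x := ρ_M (G x̃)` for a reduction homomorphism `ρ_M : ẑ → ℤ∕M` and the integral lift `x̃ = (x.val)`; (i): if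
`r₁⁻¹ŵ = x̃∕M + z`, `z ∈ ẑ^{2g}`, then `r₂⁻¹ (Q w)^ = G(r₁⁻¹ ŵ) ≡ (G x̃)∕M (mod ẑ)`, so `Q w` reads `T̄_M x` through `r₂`; (ii): `ᵗ(Gx̃) ψ (Gỹ) = νε·ᵗx̃ ψ ỹ`, reduce
by `ρ_M`, `u_M := ρ_M(ε)`. [cite: Milne2005ShimuraVarieties, §6 Thm. 6.11 p. 74 and p. 75] [cite: Deligne1971TravauxShimura, 4.12 (b) p. 149 and 4.16 p. 150]
[cite: MumfordAV1970, §20 (pp. 184–186)] -/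
theorem SiegelAdelicMarking.exists_torsionTransporter {J₁ J₂ : C0pm δ} {r₁ r₂ : gspFinAdelic δ} {A₁ A₂ : AbelianVariety ℂ}
    (m₁ : SiegelAdelicMarking J₁ r₁ A₁) (m₂ : SiegelAdelicMarking J₂ r₂ A₂) (h : A₁ ⟶ A₂)
    (Q : Matrix (Fin g ⊕ Fin g) (Fin g ⊕ Fin g) ℚ) (hh : ∀ v, AlgPoints.map h.hom.hom.hom (m₁.r v) = m₂.r (Q *ᵥ v))
    (hG : ∀ i j, ((((r₂⁻¹ : gspFinAdelic δ) : GL (Fin g ⊕ Fin g) finAdeleQ) : Matrix (Fin g ⊕ Fin g) (Fin g ⊕ Fin g) finAdeleQ) * adelicMatrix Q *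
        (((r₁ : gspFinAdelic δ) : GL (Fin g ⊕ Fin g) finAdeleQ) : Matrix (Fin g ⊕ Fin g) (Fin g ⊕ Fin g) finAdeleQ)) i j ∈
      FiniteAdeleRing.integralAdeles (𝓞 ℚ) ℚ)
    {ν : ℕ} (ε : (FiniteAdeleRing.integralAdeles (𝓞 ℚ) ℚ)ˣ)
    (hGE : ((((r₂⁻¹ : gspFinAdelic δ) : GL (Fin g ⊕ Fin g) finAdeleQ) : Matrix (Fin g ⊕ Fin g) (Fin g ⊕ Fin g) finAdeleQ) * adelicMatrix Q *
        (((r₁ : gspFinAdelic δ) : GL (Fin g ⊕ Fin g) finAdeleQ) : Matrix (Fin g ⊕ Fin g) (Fin g ⊕ Fin g) finAdeleQ))ᵀ * typeFormOver δ finAdeleQ *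
        ((((r₂⁻¹ : gspFinAdelic δ) : GL (Fin g ⊕ Fin g) finAdeleQ) : Matrix (Fin g ⊕ Fin g) (Fin g ⊕ Fin g) finAdeleQ) * adelicMatrix Q *
        (((r₁ : gspFinAdelic δ) : GL (Fin g ⊕ Fin g) finAdeleQ) : Matrix (Fin g ⊕ Fin g) (Fin g ⊕ Fin g) finAdeleQ)) =
      ((ν : finAdeleQ) * ((ε : FiniteAdeleRing.integralAdeles (𝓞 ℚ) ℚ) : finAdeleQ)) • typeFormOver δ finAdeleQ)
    {N : ℕ} (L₁ : ∀ M : ℕ, (Fin g ⊕ Fin g → ZMod M) → A₁.Points ℂ) (L₂ : ∀ M : ℕ, (Fin g ⊕ Fin g → ZMod M) → A₂.Points ℂ)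
    (hL₁ : ∀ ⦃M : ℕ⦄, N ∣ M → M ≠ 0 → ∀ (x : Fin g ⊕ Fin g → ZMod M) (w : Fin g ⊕ Fin g → ℚ),
      AdelicCongr ((r₁⁻¹ : gspFinAdelic δ) : GL (Fin g ⊕ Fin g) finAdeleQ) 1 w (fun i => ((x i).val : ℚ) / M) → L₁ M x = m₁.r w)
    (hL₂ : ∀ ⦃M : ℕ⦄, N ∣ M → M ≠ 0 → ∀ (x : Fin g ⊕ Fin g → ZMod M) (w : Fin g ⊕ Fin g → ℚ),
      AdelicCongr ((r₂⁻¹ : gspFinAdelic δ) : GL (Fin g ⊕ Fin g) finAdeleQ) 1 w (fun i => ((x i).val : ℚ) / M) → L₂ M x = m₂.r w) :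
    ∃ T : ∀ M : ℕ, (Fin g ⊕ Fin g → ZMod M) → (Fin g ⊕ Fin g → ZMod M),
      (∀ M, N ∣ M → M ≠ 0 → ∀ x, AlgPoints.map h.hom.hom.hom (L₁ M x) = L₂ M (T M x)) ∧
      (∀ M, N ∣ M → M ≠ 0 → ∃ u : ℕ, u.Coprime M ∧
        ∀ x y, AbelianSchemeOver.typeFormMod δ M (T M x) (T M y) = ((u * ν : ℕ) : ZMod M) * AbelianSchemeOver.typeFormMod δ M x y) := by
  classical
  -- names
  set R₁ := (((r₁⁻¹ : gspFinAdelic δ) : GL (Fin g ⊕ Fin g) finAdeleQ) : Matrix (Fin g ⊕ Fin g) (Fin g ⊕ Fin g) finAdeleQ) with hR₁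
  set R₂ := (((r₂⁻¹ : gspFinAdelic δ) : GL (Fin g ⊕ Fin g) finAdeleQ) : Matrix (Fin g ⊕ Fin g) (Fin g ⊕ Fin g) finAdeleQ) with hR₂
  set G := R₂ * adelicMatrix Q * (((r₁ : gspFinAdelic δ) : GL (Fin g ⊕ Fin g) finAdeleQ) : Matrix (Fin g ⊕ Fin g) (Fin g ⊕ Fin g) finAdeleQ) with hGdef
  -- the reduction homomorphisms `ρ_M : ẑ → ℤ/M`
  have hρex : ∀ M : ℕ, M ≠ 0 → ∃ ρ : FiniteAdeleRing.integralAdeles (𝓞 ℚ) ℚ →+* ZMod M,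
      ∀ (x : FiniteAdeleRing.integralAdeles (𝓞 ℚ) ℚ) (a : ℤ), (x : finAdeleQ) - (a : finAdeleQ) ∈ levelIdeal M → ρ x = a :=
    fun M hM => exists_ringHom_integralAdeles_zmod hM
  -- integral lifts and the integral vectors `G x̃`
  have hlift : ∀ {M : ℕ} (x : Fin g ⊕ Fin g → ZMod M) (j : Fin g ⊕ Fin g),
      (((x j).val : ℕ) : finAdeleQ) ∈ FiniteAdeleRing.integralAdeles (𝓞 ℚ) ℚ := fun x j => natCast_mem _ _
  have hGx : ∀ {M : ℕ} (x : Fin g ⊕ Fin g → ZMod M) (i : Fin g ⊕ Fin g),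
      (G *ᵥ fun j => (((x j).val : ℕ) : finAdeleQ)) i ∈ FiniteAdeleRing.integralAdeles (𝓞 ℚ) ℚ :=
    fun x i => mulVec_apply_mem_integralAdeles_of_forall_mem hG (fun j => hlift x j) i
  -- THE TRANSPORTER
  refine ⟨fun M x => if hM : M = 0 then x else fun i => Classical.choose (hρex M hM) ⟨_, hGx x i⟩, ?_, ?_⟩
  · -- (i) `h (L₁ M x) = L₂ M (T̄ x)`
    intro M hNM hM x
    haveI : NeZero M := ⟨hM⟩
    simp only [dif_neg hM]
    set ρ := Classical.choose (hρex M hM) with hρdef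
    have hρ := Classical.choose_spec (hρex M hM)
    obtain ⟨w, hw⟩ := SiegelAdelicMarking.exists_adelicCongr_inv_one (a := r₁) (fun i => ((x i).val : ℚ) / M)
    rw [hL₁ hNM hM x w hw, hh w]
    refine (hL₂ hNM hM _ (Q *ᵥ w) ?_).symm
    -- `r₂⁻¹ (Q w)^ ≡ (ρ (G x̃))~/M (mod ẑ)`
    refine (adelicCongr_one_intDiv_iff hM fun i => (((ρ ⟨_, hGx x i⟩).val : ℕ) : ℤ)).2 fun i => ?_
    -- `ξ := M · r₁⁻¹ ŵ`, integral, `≡ x̃ (mod M)`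
    have hξ : ∀ l, (M : finAdeleQ) * (R₁ *ᵥ adelicVec w) l - ((((x l).val : ℤ)) : finAdeleQ) ∈ levelIdeal M :=
      (adelicCongr_one_intDiv_iff hM fun l => ((x l).val : ℤ)).1 (by simpa only [Int.cast_natCast] using hw)
    -- `M · r₂⁻¹ (Q w)^ = G ξ`
    have hkey : (M : finAdeleQ) * (R₂ *ᵥ adelicVec (Q *ᵥ w)) i = (G *ᵥ fun l => (M : finAdeleQ) * (R₁ *ᵥ adelicVec w) l) i := by
      have e1 : R₂ *ᵥ adelicVec (Q *ᵥ w) = G *ᵥ (R₁ *ᵥ adelicVec w) := by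
        rw [← adelicMatrix_mulVec_adelicVec, hGdef, Matrix.mulVec_mulVec, Matrix.mulVec_mulVec, Matrix.mul_assoc,
          hR₁, ← Units.val_mul, ← Subgroup.coe_mul, mul_inv_cancel, Subgroup.coe_one, Units.val_one, Matrix.mul_one]
      have e2 : (fun l => (M : finAdeleQ) * (R₁ *ᵥ adelicVec w) l) = (M : finAdeleQ) • (R₁ *ᵥ adelicVec w) := rfl
      rw [e1, e2, Matrix.mulVec_smul, Pi.smul_apply, smul_eq_mul]
    rw [hkey, Int.cast_natCast]
    -- `G ξ - G x̃ ∈ M ẑ` and `G x̃ - ρ(G x̃).val ∈ M ẑ`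
    have h1 : (G *ᵥ fun l => (M : finAdeleQ) * (R₁ *ᵥ adelicVec w) l) i - (G *ᵥ fun j => (((x j).val : ℕ) : finAdeleQ)) i ∈ levelIdeal M := by
      rw [← Pi.sub_apply, ← Matrix.mulVec_sub]
      refine Literature.NumberTheory.Adeles.mulVec_apply_mem_levelIdeal (fun i j => (mem_integralAdeles_iff_mem_integralFiniteAdeles _).1 (hG i j))
        (fun l => ?_) i
      simpa only [Pi.sub_apply, Int.cast_natCast] using hξ l
    have h2 : (G *ᵥ fun j => (((x j).val : ℕ) : finAdeleQ)) i - ((((ρ ⟨_, hGx x i⟩).val : ℕ)) : finAdeleQ) ∈ levelIdeal M := by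
      have e := (ringHom_integralAdeles_zmod_apply_eq_intCast_iff hM hρ ⟨_, hGx x i⟩ (((ρ ⟨_, hGx x i⟩).val : ℕ) : ℤ)).1
        (by rw [Int.cast_natCast, ZMod.natCast_zmod_val])
      simpa only [Int.cast_natCast] using e
    simpa only [sub_add_sub_cancel] using add_mem h1 h2
  · -- (ii) the multiplier law
    intro M hNM hM
    haveI : NeZero M := ⟨hM⟩
    set ρ := Classical.choose (hρex M hM) with hρdef
    have hρ := Classical.choose_spec (hρex M hM)
    refine ⟨(ρ (ε : FiniteAdeleRing.integralAdeles (𝓞 ℚ) ℚ)).val, ?_, fun x y => ?_⟩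
    · obtain ⟨u, hu⟩ := (Units.isUnit ε).map ρ
      rw [← hu]
      exact ZMod.val_coe_unit_coprime u
    simp only [dif_neg hM]
    -- the integral vectors `x̃`, `ỹ`, `X = G x̃`, `Y = G ỹ`
    let ξ : Fin g ⊕ Fin g → FiniteAdeleRing.integralAdeles (𝓞 ℚ) ℚ := fun j => ⟨(((x j).val : ℕ) : finAdeleQ), hlift x j⟩
    let η : Fin g ⊕ Fin g → FiniteAdeleRing.integralAdeles (𝓞 ℚ) ℚ := fun j => ⟨(((y j).val : ℕ) : finAdeleQ), hlift y j⟩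
    let X : Fin g ⊕ Fin g → FiniteAdeleRing.integralAdeles (𝓞 ℚ) ℚ := fun i => ⟨_, hGx x i⟩
    let Y : Fin g ⊕ Fin g → FiniteAdeleRing.integralAdeles (𝓞 ℚ) ℚ := fun i => ⟨_, hGx y i⟩
    have hρξ : (fun i => ρ (ξ i)) = x := funext fun i => by
      change ρ ⟨(((x i).val : ℕ) : finAdeleQ), _⟩ = x i
      have e : (⟨(((x i).val : ℕ) : finAdeleQ), hlift x i⟩ : FiniteAdeleRing.integralAdeles (𝓞 ℚ) ℚ) = ((x i).val : ℕ) := rfl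
      rw [e, map_natCast, ZMod.natCast_zmod_val]
    have hρη : (fun i => ρ (η i)) = y := funext fun i => by
      change ρ ⟨(((y i).val : ℕ) : finAdeleQ), _⟩ = y i
      have e : (⟨(((y i).val : ℕ) : finAdeleQ), hlift y i⟩ : FiniteAdeleRing.integralAdeles (𝓞 ℚ) ℚ) = ((y i).val : ℕ) := rfl
      rw [e, map_natCast, ZMod.natCast_zmod_val]
    -- `Σ X E Y = ν ε Σ ξ E η` in `ẑ`
    have hS : ∑ i, ∑ j, X i * ((typeForm δ i j : ℤ) : FiniteAdeleRing.integralAdeles (𝓞 ℚ) ℚ) * Y j =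
        (ν : FiniteAdeleRing.integralAdeles (𝓞 ℚ) ℚ) * ((ε : FiniteAdeleRing.integralAdeles (𝓞 ℚ) ℚ) *
          ∑ i, ∑ j, ξ i * ((typeForm δ i j : ℤ) : FiniteAdeleRing.integralAdeles (𝓞 ℚ) ℚ) * η j) := by
      have hA : ∑ i, ∑ j, (X i : finAdeleQ) * ((typeForm δ i j : ℤ) : finAdeleQ) * (Y j : finAdeleQ) =
          (ν : finAdeleQ) * (((ε : FiniteAdeleRing.integralAdeles (𝓞 ℚ) ℚ) : finAdeleQ) *
            ∑ i, ∑ j, (ξ i : finAdeleQ) * ((typeForm δ i j : ℤ) : finAdeleQ) * (η j : finAdeleQ)) := by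
        rw [sum_sum_mul_typeForm_mul_eq_dotProduct, sum_sum_mul_typeForm_mul_eq_dotProduct]
        change (G *ᵥ fun j => (ξ j : finAdeleQ)) ⬝ᵥ (typeFormOver δ finAdeleQ *ᵥ (G *ᵥ fun j => (η j : finAdeleQ))) = _
        rw [dotProduct_mulVec_typeFormOver_mulVec_of_transpose_mul_mul hGE, mul_assoc]
      apply Subtype.ext
      push_cast
      exact hA
    -- reduce by `ρ`
    have hT : AbelianSchemeOver.typeFormMod δ M (fun i => ρ (X i)) (fun j => ρ (Y j)) =
        ((((ρ (ε : FiniteAdeleRing.integralAdeles (𝓞 ℚ) ℚ)).val * ν : ℕ)) : ZMod M) * AbelianSchemeOver.typeFormMod δ M x y := by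
      rw [← ringHom_sum_sum_mul_typeForm_mul, hS, map_mul, map_mul, map_natCast, ringHom_sum_sum_mul_typeForm_mul, hρξ, hρη,
        Nat.cast_mul, ZMod.natCast_zmod_val]
      ring
    exact hT

end Literature.AlgebraicGeometry.ModuliOfAbelianVarieties

end
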